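import Summits.QuantumFields.YangMills.Theorems.FluctuationComparisonRegPrIntLS2BetaPivotResolveSmooth
import Summits.QuantumFields.YangMills.Theorems.FluctuationComparisonRegPrIntLS2BetaChainDerivative
import Summits.QuantumFields.YangMills.Theorems.FluctuationComparisonRegPrIntLWregGlue
import HarnessLib

/-!
# S2β · LAPLACE row — (C2) DOCKED ON T³: THE PEANO SMOOTHNESS ROW `ContDiffAt ℝ 2 (fun y => wilsonAction4 (c.Φ (V, σ y))) 0` FROM THE WINDOW-CHART CLAUSES (pen w5-20520 g14)

Cell `ym3-torus` (rung R3: continuum `SU(2)` Yang–Mills on `T³` — NOT `d = 4`, NOT infinite volume, NOT a mass gap, NOT Clay); width seat `ym-ust-20520-w5` g14;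
helper of the crux `stmt-QuantumFields-20520` (`--supports`, NOT a proof of it).  THEOREMS ONLY (0 `def`, 0 `sorry`; default heartbeats).

WHAT.  The (C2) Peano row of the v8 docking of `Lines/semiclassical_s2beta.lean` (w4-20520 g15) for the window chart of record `c` (w3-20520 g14
✓-to-be `…ChartContLaplaceRows.exists_laplaceRows`) and the tubular transversal `σ` (px21 ✓`…S2BetaTubularChartDock.exists_tubularHaarChart_pivotAct_smooth`),
HYPOTHESIS-FREE modulo the chart CLAUSES that `exists_laplaceRows` exports about its existential `c` (so the docking is `obtain` + `exact`):
(C2-a) ✓`…S2BetaPivotReadSmooth.contDiffAt_pivotRead` (w5) ∘ (C2-b) ✓`…S2BetaChainDerivative.isInvertible_fderiv_chainRead` ∕ `chainRead_contDiffAt_surjective` (px11 g10)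
∘ (C2-c) ✓`…S2BetaPivotResolveSmooth.contDiffAt_wilsonAction4_resolve` ∕ `isInvertible_inr_of_blocks` (w5).
* §1 the regime: the UV-small history (`histGood`) puts every loop variable of `Ū⁽ᵏ⁾U₀`, `k < K − J`, below `α` once `((d+2)L)²∕4 · θ(i) ≤ α` (✓`dist1_loopHol_le`);
  `exists_gamma_chainRegime` chooses `α ≤ 1∕24`, `α < δ_2`, `157α < L^{1−d}` and `γ₁(α)` (✓`exists_gamma_forall_mul_θBal_le`) — GAP♯'s prefix shape.
* §2 `iter_eq_of_descendTo_eq` (strip `fieldShift`).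
* §3 ★★★ `contDiffAt_wilsonAction4_windowChart`: for ANY `c : WindowChart F hJK Sf O`, base point `U₀` over `V` and transversal `σ` with the displayed clauses
  (live ⇒ descends; live ⇒ off-pivot agreement; `ContinuousOn (c.Φ (V,·))` on the live set; `U₀` live and self-charted; the live set is a neighbourhood of `U₀`;
  loop history of `U₀` ≤ α below `K − J`; `σ` continuous, `σ 0 = U₀`, smooth matrix field) ⊢ `ContDiffAt ℝ m (fun y => wilsonAction4 (c.Φ (V, σ y))) 0` for every `m`.
* §4 ★★★ `contDiffAt_wilsonAction4_windowChart_of_histGood`: the same with the loop-history guard replaced by `U₀ ∈ histGood F 𝓔 θ K J` + the §1 regime inequalities.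

HONEST SCOPE.  Assembly; proves no stub; this is ONE of the two Peano rows of `stub_transversalHessian` (the growth∕transversality row (T2) is px21 g10 ∕ px11 g10's);
EXW ∕ GAP♯ ∕ DECAY ∕ H4ᶜ ∕ LFR♯ᶜ ∕ LAPLACE ∕ S2β ∕ the crux 20520 NOT proved; `YM3TorusSU2` NOT proved; the Yang–Mills mass gap (Clay) NOT proved.

References: [Balaban1987RG1] CMP 109 (1987) (0.4) p. 253, p. 267 (after (2.10)); [Balaban1985Variational] CMP 102 (1985) Thm 1 (8)–(10) p. 279; [Balaban1985UV3] CMP 102 (1985)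
(7) p. 257; [Dieudonne1960] Ch. X §2 (10.2.1)–(10.2.3).
-/

noncomputable section

open scoped Matrix.Norms.L2Operator Topology ContDiff
open Filter Set Function
open Literature.MathematicalPhysics.QuantumFieldTheory.Balaban1983to89
open Literature.MathematicalPhysics.QuantumFieldTheory.Balaban1983to89.HaarExponentialChart
open Literature.MathematicalPhysics.QuantumFieldTheory.Balaban1983to89.HaarExponentialChart.IsChartRep
open Literature.MathematicalPhysics.QuantumFieldTheory.Balaban1983to89.BlockAveraging (Small Idx avgFun loopHol blockAvg blockAvg_avg)
open Literature.MathematicalPhysics.QuantumFieldTheory.Balaban1983to89.ExpMeanLog (expMeanLogSU deltaSU deltaSU_pos)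
open Literature.MathematicalPhysics.QuantumFieldTheory.Balaban1983to89.Node00
open Literature.MathematicalPhysics.QuantumFieldTheory.Balaban1983to89.T3ContinuumYM3Torus
open Literature.MathematicalPhysics.QuantumFieldTheory.Balaban1983to89.T3UnitLawDensityEML
open Literature.MathematicalPhysics.QuantumFieldTheory.Balaban1983to89.T3UnitScaleTilt
open Literature.MathematicalPhysics.QuantumFieldTheory.Balaban1983to89.T3TiltDescent
open Literature.MathematicalPhysics.QuantumFieldTheory.Balaban1983to89.T3LevelShift
open Literature.MathematicalPhysics.QuantumFieldTheory.Balaban1983to89.T3Thresholds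
open Literature.MathematicalPhysics.QuantumFieldTheory.Balaban1983to89.LatticeWordStokes (dist1_loopHol_le)
open Summit.QuantumFields.YangMills.Theorems.FluctuationComparisonRegPrIntLWregGlue
open Summit.QuantumFields.YangMills.Theorems.FluctuationComparisonRegPrIntLWregChain (iterCentralBond iterCentralBond_injective chainMap)
open Summit.QuantumFields.YangMills.Theorems.FluctuationComparisonRegPrIntLS2BetaPivotReadSmooth
open Summit.QuantumFields.YangMills.Theorems.FluctuationComparisonRegPrIntLS2BetaPivotResolveSmooth
open Summit.QuantumFields.YangMills.Theorems.FluctuationComparisonRegPrIntLS2BetaChainDerivative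

namespace Summit.QuantumFields.YangMills.Theorems.FluctuationComparisonRegPrIntLS2BetaPeanoSmooth

/-! ## §1 The regime: UV-small history ⇒ small (0.4) loop history below the top steps -/

section Regime

variable (F : T3Family)

/-- **SMALL PLAQUETTES ⇒ SMALL LOOP HISTORY**: a field in the UV-small-history event `histGood F 𝓔 θ K J` has every (0.4) loop variable of `Ū⁽ᵏ⁾`, `k < K − J`, within
`α` of `1` as soon as `((d+2)L)²∕4 · θ(i) ≤ α` for all `i` (closed loop words of length `≤ (d+2)L`, ✓`dist1_loopHol_le`). [cite: Balaban1985UV3, (7) p.257]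
[cite: Balaban1987RG1, (0.4) p.253] -/
theorem loopHist_le_of_mem_histGood {θ : ℕ → ℝ} {K J : ℕ} {α : ℝ} (hθ0 : ∀ i, 0 ≤ θ i)
    (hθα : ∀ i, ((((F.P K).d + 2) * (F.P K).L : ℕ) : ℝ) ^ 2 / 4 * θ i ≤ α)
    {U : GaugeField (F.P K) 0 (Matrix.specialUnitaryGroup (Fin 2) ℂ)} (hU : U ∈ histGood F ℰp θ K J) :
    ∀ k, k < K - J → ∀ (c' : PBond (F.P K) (k + 1)) (i : Idx (F.P K)),
      dist1 (loopHol (Averaging.iter (fun j => blockAvg (P := F.P K) (j := j) (expMeanLogSU (n := Fin 2))) k U) c' i) ≤ α := by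
  intro k hk c' i
  have hkK : k + J ≤ K := by omega
  have hsmall : PlaqSmall (θ (K - k)) (Averaging.iter (fun j => blockAvg (P := F.P K) (j := j) (expMeanLogSU (n := Fin 2))) k U) := hU k hkK
  exact (dist1_loopHol_le (hθ0 (K - k)) hsmall c' i).trans (hθα (K - k))

/-- A loop history `≤ α < δ_N` below `n` IS the (0.4) guard `SmallBelow n`. [cite: Balaban1987RG1, (0.4) p.253 (bookkeeping)] -/
theorem smallBelow_of_loopHist_le {P : Params} {N : ℕ} [NeZero N] {α : ℝ} (hαδ : α < deltaSU (Fin N)) {n : ℕ} {U : GaugeField P 0 (SU N)}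
    (h : ∀ k, k < n → ∀ (c' : PBond P (k + 1)) (i : Idx P),
      dist1 (loopHol (Averaging.iter (fun j => blockAvg (P := P) (j := j) (expMeanLogSU (n := Fin N))) k U) c' i) ≤ α) :
    SmallBelow (fun j => blockAvg (P := P) (j := j) (expMeanLogSU (n := Fin N))) n U :=
  fun k hk c' i => (h k hk c' i).trans_lt hαδ

/-- **THE CHAIN REGIME** (GAP♯'s prefix shape): for every `L, b₀, p₀` there are `α > 0` with `α ≤ 1∕24`, `α < δ_2`, and `γ₁ > 0` such that for every family with `F.L = L` and
`0 < γ ≤ γ₁`: `157α < L^{1−d}` on every member and the Bałaban thresholds satisfy `0 ≤ θ(i)` and `((d+2)L)²∕4 · θ(i) ≤ α` (✓`exists_gamma_forall_mul_θBal_le`, ✓`θBal_pos`).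
[cite: Balaban1985UV3, (7) p.257] [cite: Balaban1987RG1, p.267 (after (2.10))] -/
theorem exists_gamma_chainRegime :
    ∀ (L : ℕ) (b₀ p₀ : ℝ), 0 < b₀ → 0 < p₀ → ∃ α γ₁ : ℝ, 0 < α ∧ α ≤ 1 / 24 ∧ α < deltaSU (Fin 2) ∧ 0 < γ₁ ∧
      ∀ (F : T3Family) (γ : ℝ), F.L = L → 0 < γ → γ ≤ γ₁ → ∀ K : ℕ,
        157 * α < ((((F.P K).L : ℕ) : ℝ) ^ ((F.P K).d - 1))⁻¹ ∧ (∀ i, 0 ≤ θBal F.L γ b₀ p₀ i) ∧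
          ∀ i, ((((F.P K).d + 2) * (F.P K).L : ℕ) : ℝ) ^ 2 / 4 * θBal F.L γ b₀ p₀ i ≤ α := by
  intro L b₀ p₀ hb hp
  -- the family members all have `d = 3`, `L = F.L`; choose `α` below `1/24`, `δ_2/2` and `(158 (L²+1))⁻¹`
  set α : ℝ := min (1 / 24) (min (deltaSU (Fin 2) / 2) (1 / (158 * ((L : ℝ) ^ 2 + 1)))) with hα
  have hαpos : 0 < α := by
    rw [hα]
    exact lt_min (by norm_num) (lt_min (half_pos deltaSU_pos) (by positivity))
  obtain ⟨γ₁, hγ₁, hγ₁1, hθ⟩ := exists_gamma_forall_mul_θBal_le (b₀ := b₀) (p₀ := p₀) hb hp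
    (B := ((((3 + 2) * L : ℕ) : ℝ) ^ 2 / 4)) (by positivity) (ε₀ := α) hαpos
  refine ⟨α, γ₁, hαpos, min_le_left _ _, lt_of_le_of_lt (le_trans (min_le_right _ _) (min_le_left _ _)) (half_lt_self deltaSU_pos), hγ₁,
    fun F γ hFL hγ hγle K => ⟨?_, fun i => (T3MinimiserStabilityReduction.θBal_pos F.hL.2.le hγ (hγle.trans hγ₁1) hb p₀ i).le, fun i => ?_⟩⟩
  · -- `157 α < (L²)⁻¹`
    have hPL : (F.P K).L = F.L := rfl
    have hL1 : (1 : ℝ) ≤ (L : ℝ) := by exact_mod_cast (hFL ▸ F.hL.2.le : 1 ≤ L)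
    have hL2 : (0 : ℝ) < (L : ℝ) ^ 2 := by positivity
    have hd : ((((F.P K).L : ℕ) : ℝ) ^ ((F.P K).d - 1)) = (L : ℝ) ^ 2 := by
      rw [T3Family.P_d, hPL, hFL]
    rw [hd]
    have hαle : α ≤ 1 / (158 * ((L : ℝ) ^ 2 + 1)) := le_trans (min_le_right _ _) (min_le_right _ _)
    have h1 : 157 * α ≤ 157 / (158 * ((L : ℝ) ^ 2 + 1)) := by
      have := mul_le_mul_of_nonneg_left hαle (by norm_num : (0 : ℝ) ≤ 157)
      simpa [div_eq_mul_inv] using this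
    have h2 : 157 / (158 * ((L : ℝ) ^ 2 + 1)) < ((L : ℝ) ^ 2)⁻¹ := by
      rw [inv_eq_one_div, div_lt_div_iff₀ (by positivity) hL2]
      nlinarith
    exact h1.trans_lt h2
  · have hPL : (F.P K).L = F.L := rfl
    have hB : ((((F.P K).d + 2) * (F.P K).L : ℕ) : ℝ) ^ 2 / 4 = ((((3 + 2) * L : ℕ) : ℝ) ^ 2 / 4) := by
      rw [T3Family.P_d, hPL, hFL]
    rw [hB]
    exact hθ F.L F.hL.2.le γ hγ hγle i

end Regime

/-! ## §2 Descending is the `fieldShift` of the iterated average -/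

section Descend

variable (F : T3Family)

/-- Two fields with the same descent to the `J`-th approximation have the same `(K − J)`-fold average (`fieldShift` is invertible). [cite: Balaban1987RG1, (0.11) p.253 (bookkeeping)] -/
theorem iter_eq_of_descendTo_eq {J K : ℕ} (hJK : J ≤ K) {U U' : GaugeField (F.P K) 0 (Matrix.specialUnitaryGroup (Fin 2) ℂ)}
    (h : descendTo F ℰp J K hJK U = descendTo F ℰp J K hJK U') :
    Averaging.iter (fun i => blockAvg (P := F.P K) (j := i) ℰp) (K - J) U =
      Averaging.iter (fun i => blockAvg (P := F.P K) (j := i) ℰp) (K - J) U' := by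
  unfold descendTo at h
  have := congrArg (fieldShift (F.sitesPerDir_eq (m := F.m) (K := J) (j := 0) (m' := F.m) (K' := K) (j' := K - J) (by omega)).symm) h
  rwa [fieldShift_fieldShift_symm, fieldShift_fieldShift_symm] at this

end Descend

/-! ## §3 The Peano smoothness row from the window-chart clauses -/

section Main

variable (F : T3Family) {J K : ℕ} (hJK : J ≤ K)
variable {dV : ℕ}

/-- ★★★ **(C2) THE WILSON ACTION OF THE CHARTED CONFIGURATION IS `C^∞` ALONG THE TRANSVERSAL.**  For ANY window chart `c` (✓F3 `WindowChart`), a corner `V`, a base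
point `U₀` over `V` and a transversal `σ` through `U₀`, assume the CLAUSES that w3-20520 g14's `exists_laplaceRows` exports for its chart — live ⇒ descends
(clause 1), live ⇒ off-pivot agreement (clauses 2+8), `ContinuousOn (c.Φ (V,·))` on the live set (clause 3), `U₀` live and self-charted (clause 7), the live set is a
neighbourhood of `U₀` (clause 11) —, the loop-history guard `≤ α` of `U₀` below `K − J` in the chain regime (`α ≤ 1∕24`, `α < δ_2`, `157α < L^{1−d}`), and px21's tube
rows (`Continuous σ`, `σ 0 = U₀`, smooth matrix field).  Then `y ↦ A(c.Φ (V, σ y))` is `C^m` at `0` for every `m` — v8's displayed Peano row at `m = 2`.  Proof: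
✓(C2-c) `contDiffAt_wilsonAction4_resolve` with `Φ := c.Φ (V,·)`, `Xc := {c.jac (V,·) ≠ 0}`; its (C2-b) row `hinv` by ✓`isInvertible_inr_of_blocks` from px11's
✓`isInvertible_fderiv_chainRead` ∕ `chainRead_contDiffAt_surjective` through ✓(C2-a) `pivotRead_base_eq_chainMap`.
[cite: Balaban1985Variational, Thm 1 (8)-(10) p.279] [cite: Balaban1987RG1, p.267 (after (2.10))] [cite: Dieudonne1960, Ch. X §2 (10.2.1)–(10.2.3)] -/
theorem contDiffAt_wilsonAction4_windowChart (hk : K - J ≤ (F.P K).m + (F.P K).K) {α : ℝ} (hα24 : α ≤ 1 / 24) (hαδ : α < deltaSU (Fin 2))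
    (hαL : 157 * α < ((((F.P K).L : ℕ) : ℝ) ^ ((F.P K).d - 1))⁻¹)
    {Sf : Set (GaugeField (F.P K) 0 (Matrix.specialUnitaryGroup (Fin 2) ℂ))} {O : Set (GaugeField (F.P J) 0 (Matrix.specialUnitaryGroup (Fin 2) ℂ))}
    (c : WindowChart F hJK Sf O) (V : GaugeField (F.P J) 0 (Matrix.specialUnitaryGroup (Fin 2) ℂ)) (U₀ : GaugeField (F.P K) 0 (Matrix.specialUnitaryGroup (Fin 2) ℂ))
    -- chart clauses (w3-20520 g14 `exists_laplaceRows`, read at `(V, U₀)`)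
    (hdesc : ∀ z, c.jac (V, z) ≠ 0 → descendTo F ℰp J K hJK (c.Φ (V, z)) = V)
    (hoff : ∀ z, c.jac (V, z) ≠ 0 → ∀ b, (∀ c', iterCentralBond (K - J) c' ≠ b) → c.Φ (V, z) b = z b)
    (hΦc : ContinuousOn (fun z => c.Φ (V, z)) {z | c.jac (V, z) ≠ 0})
    (hlive : c.jac (V, U₀) ≠ 0) (hself : c.Φ (V, U₀) = U₀) (hnhds : {z | c.jac (V, z) ≠ 0} ∈ 𝓝 U₀)
    (hU₀V : descendTo F ℰp J K hJK U₀ = V)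
    (hhist : ∀ k, k < K - J → ∀ (c' : PBond (F.P K) (k + 1)) (i : Idx (F.P K)),
      dist1 (loopHol (Averaging.iter (fun j => blockAvg (P := F.P K) (j := j) (expMeanLogSU (n := Fin 2))) k U₀) c' i) ≤ α)
    -- tube rows (px21 ✓`exists_tubularHaarChart_pivotAct_smooth`)
    (σ : EuclideanSpace ℝ (Fin dV) → GaugeField (F.P K) 0 (Matrix.specialUnitaryGroup (Fin 2) ℂ)) (hσc : Continuous σ) (hσ0 : σ 0 = U₀)
    (hσs : ContDiff ℝ ⊤ (fun y : EuclideanSpace ℝ (Fin dV) => fun b : PBond (F.P K) 0 =>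
      ((σ y b : Matrix.specialUnitaryGroup (Fin 2) ℂ) : Matrix (Fin 2) (Fin 2) ℂ)))
    (m : WithTop ℕ∞) :
    ContDiffAt ℝ m (fun y => wilsonAction4 (c.Φ (V, σ y))) 0 := by
  have hU₀ : SmallBelow (fun j => blockAvg (P := F.P K) (j := j) (expMeanLogSU (n := Fin 2))) (K - J) U₀ := smallBelow_of_loopHist_le hαδ hhist
  have hσs' : ContDiffAt ℝ ⊤ (fun y => coeField (σ y)) 0 := hσs.contDiffAt
  -- (C2-b): the pivot-derivative of the read along `σ` is invertible, block by block
  have hR := contDiffAt_pivotRead (n := K - J) U₀ hU₀ σ hσc hσ0 hσs'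
  have hinv := isInvertible_inr_of_blocks (hR.differentiableAt (by simp))
    (φ := fun c' X => (isChartRep_specialUnitaryGroup (n := Fin 2)).logChart
      (chainMap (expMeanLogSU (n := Fin 2)) (K - J) U₀ c' ((isChartRep_specialUnitaryGroup (n := Fin 2)).expChart X * U₀ (iterCentralBond (K - J) c')) *
        (Averaging.iter (fun j => blockAvg (P := F.P K) (j := j) (expMeanLogSU (n := Fin 2))) (K - J) U₀ c')⁻¹))
    (fun X c' => by
      show (isChartRep_specialUnitaryGroup (n := Fin 2)).logChart
        (Averaging.iter (fun j => blockAvg (P := F.P K) (j := j) (expMeanLogSU (n := Fin 2))) (K - J)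
            (extend (iterCentralBond (K - J)) (fun c'' => (isChartRep_specialUnitaryGroup (n := Fin 2)).expChart (X c'') * U₀ (iterCentralBond (K - J) c'')) (σ 0)) c' *
          (Averaging.iter (fun j => blockAvg (P := F.P K) (j := j) (expMeanLogSU (n := Fin 2))) (K - J) U₀ c')⁻¹) = _
      rw [hσ0]
      exact pivotRead_base_eq_chainMap hk U₀ X c')
    (fun c' => ((chainRead_contDiffAt_surjective (P := F.P K) (N := 2) hα24 hαδ hαL hk U₀ c' hhist).2.1.differentiableAt (by simp)))
    (fun c' => isInvertible_fderiv_chainRead (P := F.P K) (N := 2) hα24 hαδ hαL hk U₀ c' hhist)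
  -- (C2-c) with the chart clauses
  refine contDiffAt_wilsonAction4_resolve (n := K - J) U₀ hU₀ σ hσc hσ0 hσs' (fun z => c.Φ (V, z)) {z | c.jac (V, z) ≠ 0}
    (fun z hz b hb => hoff z hz b hb) (fun z hz => ?_) (hΦc.continuousWithinAt hlive) hself
    (hσc.continuousAt.preimage_mem_nhds (by rw [hσ0]; exact hnhds)) hinv m
  exact iter_eq_of_descendTo_eq F hJK ((hdesc z hz).trans hU₀V.symm)

/-- ★★★ **(C2) AT A POINT OF THE UV-SMALL-HISTORY EVENT**: as `contDiffAt_wilsonAction4_windowChart`, with the loop-history guard of `U₀` DERIVED from `U₀ ∈ histGood F 𝓔 θ K J`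
and the §1 regime inequalities on the thresholds (`0 ≤ θ(i)`, `((d+2)L)²∕4 · θ(i) ≤ α`; supplied uniformly in `γ ≤ γ₁` by `exists_gamma_chainRegime`).
[cite: Balaban1985UV3, (7) p.257] [cite: Balaban1985Variational, Thm 1 (8)-(10) p.279] [cite: Dieudonne1960, Ch. X §2 (10.2.1)] -/
theorem contDiffAt_wilsonAction4_windowChart_of_histGood (hk : K - J ≤ (F.P K).m + (F.P K).K) {α : ℝ} (hα24 : α ≤ 1 / 24) (hαδ : α < deltaSU (Fin 2))
    (hαL : 157 * α < ((((F.P K).L : ℕ) : ℝ) ^ ((F.P K).d - 1))⁻¹) {θ : ℕ → ℝ} (hθ0 : ∀ i, 0 ≤ θ i)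
    (hθα : ∀ i, ((((F.P K).d + 2) * (F.P K).L : ℕ) : ℝ) ^ 2 / 4 * θ i ≤ α)
    {Sf : Set (GaugeField (F.P K) 0 (Matrix.specialUnitaryGroup (Fin 2) ℂ))} {O : Set (GaugeField (F.P J) 0 (Matrix.specialUnitaryGroup (Fin 2) ℂ))}
    (c : WindowChart F hJK Sf O) (V : GaugeField (F.P J) 0 (Matrix.specialUnitaryGroup (Fin 2) ℂ)) (U₀ : GaugeField (F.P K) 0 (Matrix.specialUnitaryGroup (Fin 2) ℂ))
    (hdesc : ∀ z, c.jac (V, z) ≠ 0 → descendTo F ℰp J K hJK (c.Φ (V, z)) = V)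
    (hoff : ∀ z, c.jac (V, z) ≠ 0 → ∀ b, (∀ c', iterCentralBond (K - J) c' ≠ b) → c.Φ (V, z) b = z b)
    (hΦc : ContinuousOn (fun z => c.Φ (V, z)) {z | c.jac (V, z) ≠ 0})
    (hlive : c.jac (V, U₀) ≠ 0) (hself : c.Φ (V, U₀) = U₀) (hnhds : {z | c.jac (V, z) ≠ 0} ∈ 𝓝 U₀)
    (hU₀V : descendTo F ℰp J K hJK U₀ = V) (hU₀h : U₀ ∈ histGood F ℰp θ K J)
    (σ : EuclideanSpace ℝ (Fin dV) → GaugeField (F.P K) 0 (Matrix.specialUnitaryGroup (Fin 2) ℂ)) (hσc : Continuous σ) (hσ0 : σ 0 = U₀)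
    (hσs : ContDiff ℝ ⊤ (fun y : EuclideanSpace ℝ (Fin dV) => fun b : PBond (F.P K) 0 =>
      ((σ y b : Matrix.specialUnitaryGroup (Fin 2) ℂ) : Matrix (Fin 2) (Fin 2) ℂ)))
    (m : WithTop ℕ∞) :
    ContDiffAt ℝ m (fun y => wilsonAction4 (c.Φ (V, σ y))) 0 :=
  contDiffAt_wilsonAction4_windowChart F hJK hk hα24 hαδ hαL c V U₀ hdesc hoff hΦc hlive hself hnhds hU₀V
    (loopHist_le_of_mem_histGood F hθ0 hθα hU₀h) σ hσc hσ0 hσs m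

end Main

end Summit.QuantumFields.YangMills.Theorems.FluctuationComparisonRegPrIntLS2BetaPeanoSmooth

end
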